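import Literature.AnabelianGeometry.SemiGraphs.TemperedMaximalCompactZorn
import Literature.AnabelianGeometry.SemiGraphs.FreeGroupsAndActionsProofs4
import HarnessLib

/-!
# Maximal compact subgroups of a tempered group (Zorn): the bounded-finite-subgroup input from tree actions

Mochizuki, *Semi-graphs of anabelioids*, Publ. RIMS **42** (2006): Lemma 1.8 (ii)(a) p. 20 (a finite group
acting on a tree fixes a vertex or an edge) and §3, Def. 3.1 (i) / Thm. 3.7 (iv) pp. 33, 41 (tempered groups;
maximal compact subgroups) [cite: MochizukiSemiAnbd2006, Lem. 1.8(ii)(a) p.20]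
[cite: MochizukiSemiAnbd2006, Thm 3.7(iv) p.41].

PROOF-ONLY sequel of `TemperedMaximalCompactZorn.lean` (abc-iut cell, layer L3 frontier programme
«REFUTE-F1732», binder-form support for brick R7 / abc-iut-L3-d1's addendum (ε); seat abc-iut-w6-d120; no
definition).  The binder `hbd` of `IsTempered.exists_isMaximalCompactSubgroup_ge` («the finite subgroups of the
discrete quotients `Π/N` have bounded order along a cofinal family of open normal `N`») is DERIVED from
LEVEL DATA IN TREE CURRENCY: if along a cofinal family of open normal `N` the discrete quotient `Π/N` acts
on a tree with vertex- and edge-stabilisers (in `Π/N`) finite of order `≤ B`, then every finite subgroup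
of `Π/N` fixes a vertex or an edge (the tree's `lemma_1_8_ii_a_holds`, [SemiAnbd] Lem. 1.8 (ii)(a)), hence
has order `≤ B`:

* `SemiGraph.ncard_le_of_finite_of_treeAction` — the finite-subgroup bound for ONE faithful tree action;
* `IsTempered.exists_isMaximalCompactSubgroup_ge_of_treeLevels` — every compact subgroup of such a tempered
  group lies in a maximal compact subgroup (e.g. `π₁^temp` of a graph of anabelioids all of whose level groups
  are Bass–Serre groups of graphs of FINITE groups of bounded order, as for the countermodel candidate `𝒢_θ`).

HONEST FRAMING: nothing here bears on [IUTchIII] Cor. 3.12; no side taken; typed ≠ proved elsewhere.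
-/

namespace Literature.AnabelianGeometry.SemiGraphs

open Topology
open scoped Pointwise

universe u

/-! ### Finite subgroups of a group acting faithfully on a tree with bounded stabilisers are bounded -/

/-- **Finite subgroups under a faithful tree action with bounded stabilisers are bounded** ([SemiAnbd]
Lem. 1.8 (ii)(a): a finite group acting on a tree fixes a vertex or an edge, so a finite subgroup lies in a
stabiliser).  Currency: `ρ : Γ →* Aut X`, the stabiliser SETS `{γ | (ρ γ) v = v}` /
`{γ | (ρ γ) e = e}` finite of `ncard ≤ B`. [cite: MochizukiSemiAnbd2006, Lem. 1.8(ii)(a) p.20] -/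
theorem SemiGraph.ncard_le_of_finite_of_treeAction {Γ : Type u} [Group Γ] (X : SemiGraph.{u})
    (hX : X.IsTree) (ρ : Γ →* CategoryTheory.Aut X) {B : ℕ}
    (hv : ∀ v : X.Vertex, ({γ : Γ | (ρ γ).hom.vertexMap v = v} : Set Γ).Finite ∧
      ({γ : Γ | (ρ γ).hom.vertexMap v = v} : Set Γ).ncard ≤ B)
    (he : ∀ e : X.Edge, ({γ : Γ | (ρ γ).hom.edgeMap e = e} : Set Γ).Finite ∧
      ({γ : Γ | (ρ γ).hom.edgeMap e = e} : Set Γ).ncard ≤ B)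
    (H : Subgroup Γ) (hH : (H : Set Γ).Finite) : Nat.card H ≤ B := by
  classical
  haveI : Finite H := hH.to_subtype
  -- the finite group `H` acts on the tree through `ρ`
  rcases lemma_1_8_ii_a_holds X H (ρ.comp H.subtype) hX with ⟨v, hvfix⟩ | ⟨e, hefix⟩
  · have hsub : (H : Set Γ) ⊆ {γ : Γ | (ρ γ).hom.vertexMap v = v} := fun γ hγ => hvfix ⟨γ, hγ⟩
    have hcard : Nat.card H = (H : Set Γ).ncard := Nat.card_coe_set_eq (H : Set Γ)
    rw [hcard]
    exact (Set.ncard_le_ncard hsub (hv v).1).trans (hv v).2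
  · have hsub : (H : Set Γ) ⊆ {γ : Γ | (ρ γ).hom.edgeMap e = e} := fun γ hγ => hefix ⟨γ, hγ⟩
    have hcard : Nat.card H = (H : Set Γ).ncard := Nat.card_coe_set_eq (H : Set Γ)
    rw [hcard]
    exact (Set.ncard_le_ncard hsub (he e).1).trans (he e).2

/-! ### Maximal compact subgroups from tree-action level data -/

variable {T : Type u} [Group T] [TopologicalSpace T] [IsTopologicalGroup T]

/-- **Every compact subgroup of a tempered group with bounded tree-action levels lies in a maximal compact
subgroup**: the binder `hbd` of `IsTempered.exists_isMaximalCompactSubgroup_ge` discharged by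
`SemiGraph.ncard_le_of_finite_of_treeAction` at each level.  Binder `hlev`: along a cofinal family of open
normal `N`, a tree `X` with an action of `Π/N` whose vertex- and edge-stabilisers IN `Π/N` are finite of
order `≤ B` (so the action is faithful up to a finite kernel; Bass–Serre level groups of graphs of finite
groups of bounded order).
[cite: MochizukiSemiAnbd2006, Thm 3.7(iv) p.41] -/
theorem IsTempered.exists_isMaximalCompactSubgroup_ge_of_treeLevels (hT : IsTempered T)
    (hlev : ∀ U ∈ 𝓝 (1 : T), ∃ N : OpenNormalSubgroup T, (N : Set T) ⊆ U ∧
      ∃ (X : SemiGraph.{u}) (ρ : T ⧸ N.toSubgroup →* CategoryTheory.Aut X) (B : ℕ),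
        X.IsTree ∧
        (∀ v : X.Vertex, ({γ | (ρ γ).hom.vertexMap v = v} : Set (T ⧸ N.toSubgroup)).Finite ∧
          ({γ | (ρ γ).hom.vertexMap v = v} : Set (T ⧸ N.toSubgroup)).ncard ≤ B) ∧
        (∀ e : X.Edge, ({γ | (ρ γ).hom.edgeMap e = e} : Set (T ⧸ N.toSubgroup)).Finite ∧
          ({γ | (ρ γ).hom.edgeMap e = e} : Set (T ⧸ N.toSubgroup)).ncard ≤ B))
    (C : Subgroup T) (hC : IsCompact (C : Set T)) :
    ∃ K : Subgroup T, IsMaximalCompactSubgroup K ∧ C ≤ K := by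
  refine hT.exists_isMaximalCompactSubgroup_ge (fun U hU => ?_) C hC
  obtain ⟨N, hNU, X, ρ, B, hX, hv, he⟩ := hlev U hU
  exact ⟨N, hNU, B, fun H hH => SemiGraph.ncard_le_of_finite_of_treeAction X hX ρ hv he H hH⟩

/-- The same with `C = ⊥`: **maximal compact subgroups exist** in a tempered group with bounded
tree-action levels. [cite: MochizukiSemiAnbd2006, Thm 3.7(iv) p.41] -/
theorem IsTempered.exists_isMaximalCompactSubgroup_of_treeLevels (hT : IsTempered T)
    (hlev : ∀ U ∈ 𝓝 (1 : T), ∃ N : OpenNormalSubgroup T, (N : Set T) ⊆ U ∧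
      ∃ (X : SemiGraph.{u}) (ρ : T ⧸ N.toSubgroup →* CategoryTheory.Aut X) (B : ℕ),
        X.IsTree ∧
        (∀ v : X.Vertex, ({γ | (ρ γ).hom.vertexMap v = v} : Set (T ⧸ N.toSubgroup)).Finite ∧
          ({γ | (ρ γ).hom.vertexMap v = v} : Set (T ⧸ N.toSubgroup)).ncard ≤ B) ∧
        (∀ e : X.Edge, ({γ | (ρ γ).hom.edgeMap e = e} : Set (T ⧸ N.toSubgroup)).Finite ∧
          ({γ | (ρ γ).hom.edgeMap e = e} : Set (T ⧸ N.toSubgroup)).ncard ≤ B)) :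
    ∃ K : Subgroup T, IsMaximalCompactSubgroup K := by
  obtain ⟨K, hK, -⟩ := hT.exists_isMaximalCompactSubgroup_ge_of_treeLevels hlev ⊥
    (by rw [Subgroup.coe_bot]; exact isCompact_singleton)
  exact ⟨K, hK⟩

end Literature.AnabelianGeometry.SemiGraphs
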